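import Mathlib
import Literature.Analysis.FluidPDE.HardSphereCollisionRecord
import Literature.MathematicalPhysics.KineticTheory.HardSphereEuler
import Literature.MathematicalPhysics.KineticTheory.HardSphereEulerProofs
import Summits.AtomisticToContinuum.HydrodynamicLimit.Theses.OneFlightGossipEngine
import Summits.AtomisticToContinuum.HydrodynamicLimit.Theorems.OneFlightGossipEngineOneFlightLayeredChaosRegimes
import Summits.AtomisticToContinuum.HydrodynamicLimit.Theorems.OneFlightGossipEngineOneFlightLayeredChaosFluxRegimes
import Summits.AtomisticToContinuum.HydrodynamicLimit.Theorems.OneFlightGossipEngineOneFlightLayeredChaosGapMeasurable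
import Summits.AtomisticToContinuum.HydrodynamicLimit.Theorems.OneFlightGossipEngineOneFlightLayeredChaosSameStartWrap
import Summits.AtomisticToContinuum.HydrodynamicLimit.Theorems.OneFlightGossipEngineOneFlightLayeredChaosFirstFlightVelInput
import Summits.AtomisticToContinuum.HydrodynamicLimit.Theorems.OneFlightGossipEngineOneFlightLayeredChaosDiscRegimes
import Summits.AtomisticToContinuum.HydrodynamicLimit.Theorems.OneFlightGossipEngineOneFlightLayeredChaosDiscTransfer
import Summits.AtomisticToContinuum.HydrodynamicLimit.Theorems.OneFlightGossipEngineOneFlightLayeredChaosFirstFlightGhostInput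
import Summits.AtomisticToContinuum.HydrodynamicLimit.Theorems.OneFlightGossipEngineOneFlightLayeredChaosFirstFlightGhostTransfer
import Summits.AtomisticToContinuum.HydrodynamicLimit.Theorems.OneFlightGossipEngineOneFlightLayeredChaosTransQuasiInv
import Summits.AtomisticToContinuum.HydrodynamicLimit.Theorems.OneFlightGossipEngineOneFlightLayeredChaosTransQuasiInvTransfer
import Summits.AtomisticToContinuum.HydrodynamicLimit.Theorems.OneFlightGossipEngineOneFlightLayeredChaosNoWrapThreshold
import HarnessLib

/-!
# `OneFlightGossipEngine.OneFlightLayeredChaos` — the GLUE of line `Sketch`: the crux from its three typed inputs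
(crux stmt-AtomisticToContinuum-14535, line `Sketch`, lead cycle c4, 2026-08-17)

The line `Sketch` (lead cycles -0 … c3) reduced the crux `OneFlightLayeredChaos` to three typed dynamical inputs,
all `def … : Prop` LANDED in the frame `Theorems.OLC`:

* `OLC.FirstFlightGhostInput θ₀` — the FIRST RUNG (`n = 0`, same flight start, fresh partner): conditional
  Stosszahlansatz of one tagged pair against the equilibrium ghost environment, velocities frozen, positions
  hard-core uniform, `N`-body flow removed (`…FirstFlightGhostInput.lean`);
* `OLC.RegimeTransQuasiInvBody θ₀ X` on the SHORT-GAP regime `X = shortGap θ₀ (1/20) ∖ shortGap θ₀ 0` and on the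
  LONG-GAP regime `X = (shortGap θ₀ (1/20))ᶜ` — event-level translation quasi-invariance, given the coarse past, of
  the transverse offset of the colliding pair at the later flight start (`…TransQuasiInv.lean`).

This file is the line's COMPOSITION as a closed theorem of the tree (previously it lived only in the registered
skeleton `Cruxes/OneFlightLayeredChaos/Lines/Sketch.lean`, around three `sorry`s):

* `regimeBody_of_transQuasiInvBody` — on ANY regime, translation quasi-invariance ⇒ the crux's body
  (`regimeDiscBody_of_transQuasiInv` p136348 ∘ `regimeFluxBody_of_regimeDiscBody` p132181 with `NoWrap θ₀ 8⁻¹` from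
  `noWrap_of_threshold` p133996 ∘ `stub_flux_transfer` p126158);
* `regimeBody_sameStart_of_ghostInput` — the ghost input ⇒ the body on the same-start event `shortGap θ₀ 0`
  (first rung `firstFlightVelInput_of_ghostInput` p137050 ∘ `regimeFluxBody_firstFlight_of_velInput` p135058 on
  `{n = 0}`, glued with the CLOSED torus wrap-around piece `regimeBody_sameStart_wrap` p135189 on `{n ≥ 1}`);
* `regimeBody_univ_of_inputs` / `oneFlightLayeredChaos_of_inputs` — THREE-input glue (the registered stubs
  `stub_firstFlight_ghostInput`, `stub_shortGap_tqi`, `stub_longGap_tqi` of skeleton v3/v4 verbatim) ⇒ the crux BY NAME;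
* `regimeBody_univ_of_two_inputs` / `oneFlightLayeredChaos_of_two_inputs` — TWO-input variant in which the two gap
  regimes are merged into the single nonzero-gap regime `(shortGap θ₀ 0)ᶜ` (the cut at `mfTime/20` is a choice of
  the line, not of the mathematics; a prover of the merged input may re-split with `regimeBody_split`).

Purpose (lead c4): the three inputs are each crux-sized (unprinted theorems of kinetic theory at fixed small
density — lead notes `Cruxes/OneFlightLayeredChaos/NOTES.md` §E2, §F); this glue is the proof of the GLUE ITEM of
a split of stmt-14535 into those inputs, so that promoting them to items is mechanical. No new definitions.
-/

open scoped BigOperators ENNReal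
open MeasureTheory Set
open Literature.Analysis.FluidPDE Literature.MathematicalPhysics.KineticTheory
open Summit.AtomisticToContinuum.HydrodynamicLimit.Theorems

namespace Summit.AtomisticToContinuum.HydrodynamicLimit.Theorems.OLC

noncomputable section

/-! ## The two transfers, packaged -/

/-- **No wrap-around at threshold `1/8`** in the frame's form `NoWrap θ₀ 8⁻¹` (from `noWrap_of_threshold`,
p133996): the no-wrap brick consumed by the disc transfer. [folklore] -/
theorem noWrap_one_eighth {θ₀ : ℝ} (hθ : 0 < θ₀) : NoWrap θ₀ 8⁻¹ :=
  fun _σ hσ hσ2 _τ hτ _δ hδ => noWrap_of_threshold hθ (by norm_num) hσ hσ2 hτ hδ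

/-- **Translation quasi-invariance ⇒ the crux's body, on any regime.** Chain of the landed transfers:
quasi-invariance of the `(ĝ, b)`-law ⇒ disc-uniformity (`regimeDiscBody_of_transQuasiInv`) ⇒ flux form of the
impact vector (`regimeFluxBody_of_regimeDiscBody`, using no-wrap at `1/8`) ⇒ the crux's own body on the regime
(`stub_flux_transfer`, kinematics + 3-D isotropy). [folklore] -/
theorem regimeBody_of_transQuasiInvBody {θ₀ : ℝ} (hθ : 0 < θ₀) (X : Regime) (h : RegimeTransQuasiInvBody θ₀ X) :
    RegimeBody θ₀ X :=
  stub_flux_transfer X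
    (regimeFluxBody_of_regimeDiscBody hθ X (regimeDiscBody_of_transQuasiInv hθ X h) (noWrap_one_eighth hθ))

/-- **The ghost input ⇒ the crux's body on the first-flight atom** `{s_i = s_j} ∩ {n = 0}` (ghost form ⇒ velocity-fibre
form ⇒ flux form ⇒ body). [folklore] -/
theorem regimeBody_firstFlight_of_ghostInput {θ₀ : ℝ} (hθ : 0 < θ₀) (h : FirstFlightGhostInput θ₀) :
    RegimeBody θ₀ ((shortGap θ₀ 0).inter nZero) :=
  stub_flux_transfer _ (regimeFluxBody_firstFlight_of_velInput hθ (firstFlightVelInput_of_ghostInput hθ h))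

/-- **The ghost input ⇒ the crux's body on the whole same-start event** `shortGap θ₀ 0 = {s_i = s_j}`: split along
`nZero = {n = 0}` (measurable on the good set, `measurableSet_good_inter_nZero`); the piece `{n ≥ 1}` is the torus
wrap-around double collision, CLOSED unconditionally (`regimeBody_sameStart_wrap`, p135189). [folklore] -/
theorem regimeBody_sameStart_of_ghostInput {θ₀ : ℝ} (hθ : 0 < θ₀) (h : FirstFlightGhostInput θ₀) :
    RegimeBody θ₀ (shortGap θ₀ 0) :=
  regimeBody_split hθ (X := shortGap θ₀ 0) (Y := nZero) measurableSet_good_inter_nZero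
    (regimeBody_firstFlight_of_ghostInput hθ h) (regimeBody_sameStart_wrap hθ)

/-- The short-gap regimes are measurable on the good set, for every cut `c` (landed `stub_measurableSet_gap_le`,
p98225). [folklore] -/
theorem measurableSet_good_inter_shortGap' (θ₀ c σ : ℝ) (n N : ℕ)
    (Φ : HardSphereFlow (Torus.geometry (Fin 3)) (hsDiameter σ N) (N + 1)) (i : Fin (N + 1)) :
    MeasurableSet (Φ.good ∩ shortGap θ₀ c σ n N Φ i) :=
  stub_measurableSet_gap_le Φ i n (c * mfTime σ θ₀ N)

/-- The same-start atom is the intersection of the two nested short-gap regimes: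
`shortGap θ₀ c ∩ shortGap θ₀ 0 = shortGap θ₀ 0` for `0 ≤ c` (pointwise, `mfTime ≥ 0`). [folklore] -/
theorem shortGap_inter_shortGap_zero {θ₀ c : ℝ} (hc : 0 ≤ c) :
    (shortGap θ₀ c).inter (shortGap θ₀ 0) = shortGap θ₀ 0 := by
  funext σ n N Φ i
  ext z
  simp only [Regime.inter, shortGap, Set.mem_inter_iff, Set.mem_setOf_eq, zero_mul]
  constructor
  · exact fun h => h.2
  · intro h
    refine ⟨h.trans ?_, h⟩
    have hm : 0 ≤ mfTime σ θ₀ N := by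
      unfold mfTime
      exact div_nonneg (Real.rpow_nonneg (by positivity) _) (by positivity)
    positivity

/-! ## The split along the same-start event -/

/-- **The body on all initial data from the body on the same-start event and on the nonzero-gap event**:
`univ = shortGap(0) ⊔ shortGap(0)ᶜ`, a split along an event measurable on the good set (`regimeBody_univ_of_split`,
landed p96961). [folklore] -/
theorem regimeBody_univ_of_sameStart_of_nonzeroGap {θ₀ : ℝ} (hθ : 0 < θ₀) (hs : RegimeBody θ₀ (shortGap θ₀ 0))
    (hg : RegimeBody θ₀ (shortGap θ₀ 0).compl) : RegimeBody θ₀ Regime.univ :=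
  regimeBody_univ_of_split hθ (Y := shortGap θ₀ 0) (measurableSet_good_inter_shortGap' θ₀ 0) hs hg

/-- **The nonzero-gap body from the two gap inputs of the line**: translation quasi-invariance on the SHORT-GAP regime
`shortGap(c) ∖ shortGap(0)` and on the LONG-GAP regime `shortGap(c)ᶜ` (any cut `c ≥ 0`; the line uses `c = 1/20`, i.e.
`mfTime/20`) give the crux's body on `shortGap(0)ᶜ = {s_i ≠ s_j}`: transfer each to a body
(`regimeBody_of_transQuasiInvBody`) and split `shortGap(0)ᶜ` along `shortGap(c)`
(`shortGap(0)ᶜ ∩ shortGap(c) = shortGap(c) ∩ shortGap(0)ᶜ`, `shortGap(0)ᶜ ∩ shortGap(c)ᶜ = shortGap(c)ᶜ` as `shortGap(0) ⊆ shortGap(c)`).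
[folklore] -/
theorem regimeBody_nonzeroGap_of_gap_inputs {θ₀ c : ℝ} (hθ : 0 < θ₀) (hc : 0 ≤ c)
    (h₂ : RegimeTransQuasiInvBody θ₀ ((shortGap θ₀ c).inter (shortGap θ₀ 0).compl))
    (h₃ : RegimeTransQuasiInvBody θ₀ (shortGap θ₀ c).compl) : RegimeBody θ₀ (shortGap θ₀ 0).compl := by
  refine regimeBody_split hθ (X := (shortGap θ₀ 0).compl) (Y := shortGap θ₀ c)
    (measurableSet_good_inter_shortGap' θ₀ c) ?_ ?_
  · have e : (shortGap θ₀ 0).compl.inter (shortGap θ₀ c) = (shortGap θ₀ c).inter (shortGap θ₀ 0).compl := by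
      funext σ n N Φ i
      exact Set.inter_comm _ _
    rw [e]
    exact regimeBody_of_transQuasiInvBody hθ _ h₂
  · have e : (shortGap θ₀ 0).compl.inter (shortGap θ₀ c).compl = (shortGap θ₀ c).compl := by
      have hsub := shortGap_inter_shortGap_zero (θ₀ := θ₀) hc
      funext σ n N Φ i
      ext z
      have hz : z ∈ shortGap θ₀ 0 σ n N Φ i → z ∈ shortGap θ₀ c σ n N Φ i := fun h => by
        have := congrArg (fun X : Regime => z ∈ X σ n N Φ i) hsub
        simp only [Regime.inter, Set.mem_inter_iff, eq_iff_iff] at this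
        exact (this.2 h).1
      simp only [Regime.inter, Regime.compl, Set.mem_inter_iff, Set.mem_compl_iff]
      tauto
    rw [e]
    exact regimeBody_of_transQuasiInvBody hθ _ h₃

/-! ## Three-input glue (the registered stubs of skeleton v3/v4 verbatim) -/

/-- **The crux's body on all initial data from the three typed inputs** (first rung in ghost form; translation
quasi-invariance on the short-gap regime `shortGap(1/20) ∖ shortGap(0)` and on the long-gap regime `shortGap(1/20)ᶜ`):
the composition `regimeBody_univ` of the registered skeleton `Lines/Sketch.lean` with its three `sorry`d stubs
turned into hypotheses (`univ = shortGap(0) ⊔ shortGap(0)ᶜ`, the first piece by `regimeBody_sameStart_of_ghostInput`,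
the second by `regimeBody_nonzeroGap_of_gap_inputs`). [folklore] -/
theorem regimeBody_univ_of_inputs {θ₀ : ℝ} (hθ : 0 < θ₀) (h₁ : FirstFlightGhostInput θ₀)
    (h₂ : RegimeTransQuasiInvBody θ₀ ((shortGap θ₀ (1 / 20)).inter (shortGap θ₀ 0).compl))
    (h₃ : RegimeTransQuasiInvBody θ₀ (shortGap θ₀ (1 / 20)).compl) : RegimeBody θ₀ Regime.univ :=
  regimeBody_univ_of_sameStart_of_nonzeroGap hθ (regimeBody_sameStart_of_ghostInput hθ h₁)
    (regimeBody_nonzeroGap_of_gap_inputs hθ (by norm_num) h₂ h₃)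

/-- **GLUE (three inputs): the crux BY NAME from the three typed inputs of line `Sketch`** — for every temperature,
the first-rung ghost input, and translation quasi-invariance on the short-gap and on the long-gap regime, imply
`OneFlightLayeredChaos` (`∃ ρ` witnessed by `ρ⋆(σ)`, the activity cancelling from the canonical law:
`oneFlightLayeredChaos_of_regimeBody_univ`, p96961). The proof of the glue item of a split of
stmt-AtomisticToContinuum-14535 into these three inputs. [folklore] -/
theorem oneFlightLayeredChaos_of_inputs : (∀ θ₀ : ℝ, 0 < θ₀ → Summit.AtomisticToContinuum.HydrodynamicLimit.Theorems.OLC.FirstFlightGhostInput θ₀) → (∀ θ₀ : ℝ, 0 < θ₀ → Summit.AtomisticToContinuum.HydrodynamicLimit.Theorems.OLC.RegimeTransQuasiInvBody θ₀ ((Summit.AtomisticToContinuum.HydrodynamicLimit.Theorems.OLC.shortGap θ₀ (1 / 20)).inter (Summit.AtomisticToContinuum.HydrodynamicLimit.Theorems.OLC.shortGap θ₀ 0).compl)) → (∀ θ₀ : ℝ, 0 < θ₀ → Summit.AtomisticToContinuum.HydrodynamicLimit.Theorems.OLC.RegimeTransQuasiInvBody θ₀ (Summit.AtomisticToContinuum.HydrodynamicLimit.Theorems.OLC.shortGap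 θ₀ (1 / 20)).compl) → Summit.AtomisticToContinuum.HydrodynamicLimit.Theses.OneFlightGossipEngine.OneFlightLayeredChaos := by
  intro h₁ h₂ h₃
  exact oneFlightLayeredChaos_of_regimeBody_univ fun θ₀ hθ =>
    regimeBody_univ_of_inputs hθ (h₁ θ₀ hθ) (h₂ θ₀ hθ) (h₃ θ₀ hθ)

/-! ## Two-input glue (gap regimes merged) -/

/-- **The crux's body on all initial data from TWO typed inputs**: the first-rung ghost input and translation
quasi-invariance on the single NONZERO-GAP regime `(shortGap θ₀ 0)ᶜ = {s_i ≠ s_j}`. (The cut of the nonzero-gap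
event at `mfTime/20` in the three-input form is a choice of the line, not of the mathematics.) [folklore] -/
theorem regimeBody_univ_of_two_inputs {θ₀ : ℝ} (hθ : 0 < θ₀) (h₁ : FirstFlightGhostInput θ₀)
    (h₂ : RegimeTransQuasiInvBody θ₀ (shortGap θ₀ 0).compl) : RegimeBody θ₀ Regime.univ :=
  regimeBody_univ_of_sameStart_of_nonzeroGap hθ (regimeBody_sameStart_of_ghostInput hθ h₁)
    (regimeBody_of_transQuasiInvBody hθ _ h₂)

/-- **GLUE (two inputs): the crux BY NAME from the first-rung ghost input and translation quasi-invariance on the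
nonzero-gap regime.** [folklore] -/
theorem oneFlightLayeredChaos_of_two_inputs : (∀ θ₀ : ℝ, 0 < θ₀ → Summit.AtomisticToContinuum.HydrodynamicLimit.Theorems.OLC.FirstFlightGhostInput θ₀) → (∀ θ₀ : ℝ, 0 < θ₀ → Summit.AtomisticToContinuum.HydrodynamicLimit.Theorems.OLC.RegimeTransQuasiInvBody θ₀ (Summit.AtomisticToContinuum.HydrodynamicLimit.Theorems.OLC.shortGap θ₀ 0).compl) → Summit.AtomisticToContinuum.HydrodynamicLimit.Theses.OneFlightGossipEngine.OneFlightLayeredChaos := by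
  intro h₁ h₂
  exact oneFlightLayeredChaos_of_regimeBody_univ fun θ₀ hθ => regimeBody_univ_of_two_inputs hθ (h₁ θ₀ hθ) (h₂ θ₀ hθ)

end

end Summit.AtomisticToContinuum.HydrodynamicLimit.Theorems.OLC
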